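import Mathlib.NumberTheory.NumberField.Units.DirichletTheorem
import HarnessLib

/-!
# Rigidity of the archimedean normalisations in the product formula of a number field

Classical algebraic number theory (a corollary of Dirichlet's unit theorem, in Mathlib as
`NumberField.Units.dirichletUnitTheorem.unitLattice_span_eq_top`): the archimedean weights of the product
formula are UNIQUELY determined by the nonarchimedean ones.

Precisely: let `K` be a number field and, for each archimedean place `w`, let `[K_w:ℝ] = w.mult` and
`|·|_w = w`. The product formula reads `Σ_{v ∤ ∞} ord_v(x)·log q_v = Σ_{w | ∞} [K_w:ℝ]·log|x|_w` for every
`x ∈ K^×` (Mathlib `NumberField.prod_abs_eq_one`; for units `NumberField.Units.sum_mult_mul_log`). THEOREM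
(`archWeights_eq_one`): if real numbers `λ_w` (`w | ∞`) satisfy
`Σ_w λ_w·[K_w:ℝ]·log|x|_w = Σ_w [K_w:ℝ]·log|x|_w` for every `x ∈ K^×` — i.e. the re-weighted archimedean degree
ALSO balances the nonarchimedean degree of every principal divisor — then `λ_w = 1` for every `w`. The proof:
`μ = λ − 1` kills the log-embedding of every unit, so `w ↦ μ_w − μ_{w₀}` is a linear functional on Dirichlet's
log-space vanishing on the unit lattice, whose `ℝ`-span is everything (`unitLattice_span_eq_top`); hence `μ` is
constant, and testing against `x = 2` (all of whose archimedean logarithms equal `log 2 > 0`) gives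
`μ·[K:ℚ]·log 2 = 0`, so `μ = 0` (`linearForm_eq_zero_of_forall_units`, `eq_zero_of_units_and_trace`).

Use in the abc-iut cell (layer L6, seat abc-iut-w4-d035 gen 8, row IUTchII:Rmk4.6.1, piece «RMK461-CURRENCY»): this
is the mathematical content of S. Mochizuki, *Inter-universal Teichmüller theory II*, Remark 4.6.1 (kurims
Dec-2020 manuscript p. 140 l. 15–27): "if one reconstructs both `Ψ^ss_cns(‡𝔉⊢) ⥲ Ψ^ss_cns(‡𝔇⊢)` and `‡𝒞⊩ ⥲ 𝒟⊩(‡𝔇⊢)`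
in a compatible fashion, then the distinguished elements at `v ∈ 𝕍^arc` may be computed … from the distinguished
elements at `v ∈ 𝕍^non`, together with the structure of the global Frobenioids `‡𝒞⊩`, `𝒟⊩(‡𝔇⊢)`, i.e., by thinking
of these global Frobenioids as «devices for currency exchange» between the various «local currencies»
constituted by the divisor monoids at the various `v ∈ 𝕍`" [cite: Mochizuki2012, Rmk 4.6.1 p.140] — read at the
number-field model: the "structure of the global Frobenioid" is its rational-function monoid `K^×` with the
principal divisors, the nonarchimedean "currencies" are pinned intrinsically (`ord_v`, `q_v`), and the theorem says
the archimedean exchange rates are then forced. Nothing here bears on [IUTchIII] Cor. 3.12; no statement of the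
disputed corpus is used — the file is Mathlib-only.
-/

namespace Literature.NumberTheory.NumberFields

open NumberField NumberField.InfinitePlace NumberField.Units NumberField.Units.dirichletUnitTheorem
open scoped Classical

variable {K : Type*} [Field K] [NumberField K]

/-- A linear form `y ↦ Σ_{w ≠ w₀} c_w·y_w` on Dirichlet's log-space that vanishes on the log-embedding of every unit
vanishes identically — because the `ℝ`-span of the unit lattice is the whole log-space
(`unitLattice_span_eq_top`, the heart of Dirichlet's unit theorem). [cite: Mochizuki2012, Rmk 4.6.1 p.140] -/
theorem linearForm_eq_zero_of_forall_units (c : {w : InfinitePlace K // w ≠ w₀} → ℝ)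
    (hc : ∀ u : (𝓞 K)ˣ, ∑ w : {w : InfinitePlace K // w ≠ w₀}, c w * logEmbedding K (Additive.ofMul u) w = 0) :
    c = 0 := by
  let ℓ : logSpace K →ₗ[ℝ] ℝ :=
    { toFun := fun y => ∑ w, c w * y w
      map_add' := fun y z => by
        simp only [Pi.add_apply, mul_add, Finset.sum_add_distrib]
      map_smul' := fun r y => by
        simp only [Pi.smul_apply, smul_eq_mul, RingHom.id_apply, Finset.mul_sum]
        exact Finset.sum_congr rfl fun w _ => by ring }
  have hker : (unitLattice K : Set (logSpace K)) ⊆ (LinearMap.ker ℓ : Set (logSpace K)) := by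
    intro y hy
    obtain ⟨x, -, rfl⟩ := (Submodule.mem_map.1 hy)
    rw [SetLike.mem_coe, LinearMap.mem_ker]
    exact hc (Additive.toMul x)
  have htop : (⊤ : Submodule ℝ (logSpace K)) ≤ LinearMap.ker ℓ := by
    rw [← unitLattice_span_eq_top]
    exact Submodule.span_le.2 hker
  funext w
  have hw : ℓ (Pi.single w 1) = 0 := LinearMap.mem_ker.1 (htop Submodule.mem_top)
  have : ℓ (Pi.single w 1) = c w := by
    change ∑ w', c w' * (Pi.single w (1 : ℝ) : logSpace K) w' = c w
    rw [Finset.sum_eq_single w]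
    · simp
    · intro w' _ hw'
      rw [Pi.single_eq_of_ne hw', mul_zero]
    · intro h
      exact absurd (Finset.mem_univ w) h
  rw [this] at hw
  exact hw

/-- **Rigidity of the archimedean weights, homogeneous form.** If `μ : 𝕍(K)^arc → ℝ` kills the weighted
log-vector of every unit, `Σ_w μ_w·[K_w:ℝ]·log|u|_w = 0`, and has total weight `Σ_w μ_w·[K_w:ℝ] = 0`, then `μ = 0`.
(The unit hypothesis forces `μ` to be CONSTANT by Dirichlet; the trace hypothesis then forces the constant to be
`0`, as `Σ_w [K_w:ℝ] = [K:ℚ] > 0`.) [cite: Mochizuki2012, Rmk 4.6.1 p.140] -/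
theorem eq_zero_of_units_and_trace (μ : InfinitePlace K → ℝ)
    (hunit : ∀ u : (𝓞 K)ˣ, ∑ w : InfinitePlace K, μ w * ((w.mult : ℝ) * Real.log (w (u : K))) = 0)
    (htrace : ∑ w : InfinitePlace K, μ w * (w.mult : ℝ) = 0) : μ = 0 := by
  -- Step 1: `μ` is constant, `μ w = μ w₀`.
  have hconst : ∀ w : InfinitePlace K, μ w = μ (w₀ : InfinitePlace K) := by
    have hc := linearForm_eq_zero_of_forall_units (K := K) (fun w => μ w.1 - μ (w₀ : InfinitePlace K)) (fun u => by
      have h1 := hunit u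
      have h2 := sum_mult_mul_log u
      rw [Fintype.sum_eq_add_sum_subtype_ne _ (w₀ : InfinitePlace K)] at h1 h2
      have e : ∀ w : {w : InfinitePlace K // w ≠ w₀},
          (μ w.1 - μ (w₀ : InfinitePlace K)) * logEmbedding K (Additive.ofMul u) w =
            μ w.1 * ((w.1.mult : ℝ) * Real.log (w.1 (u : K))) -
              μ (w₀ : InfinitePlace K) * ((w.1.mult : ℝ) * Real.log (w.1 (u : K))) := fun w => by
        rw [logEmbedding_component, sub_mul]
      simp only [e, Finset.sum_sub_distrib, ← Finset.mul_sum]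
      -- `Σ' μ·a = -μ₀ a₀` and `Σ' a = -a₀`
      have h1' : ∑ w : {w : InfinitePlace K // w ≠ w₀}, μ w.1 * ((w.1.mult : ℝ) * Real.log (w.1 (u : K))) =
          -(μ (w₀ : InfinitePlace K) *
            (((w₀ : InfinitePlace K).mult : ℝ) * Real.log ((w₀ : InfinitePlace K) (u : K)))) := by linarith
      have h2' : ∑ w : {w : InfinitePlace K // w ≠ w₀}, ((w.1.mult : ℝ) * Real.log (w.1 (u : K))) =
          -(((w₀ : InfinitePlace K).mult : ℝ) * Real.log ((w₀ : InfinitePlace K) (u : K))) := by linarith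
      rw [h1', h2']
      ring)
    intro w
    by_cases hw : w = (w₀ : InfinitePlace K)
    · rw [hw]
    · have := congrFun hc ⟨w, hw⟩
      simpa [sub_eq_zero] using this
  -- Step 2: the constant is `0`.
  have hsum : ∑ w : InfinitePlace K, μ w * (w.mult : ℝ) = μ (w₀ : InfinitePlace K) * (Module.finrank ℚ K : ℝ) := by
    rw [show (Module.finrank ℚ K : ℝ) = ∑ w : InfinitePlace K, (w.mult : ℝ) by
      rw [← sum_mult_eq, Nat.cast_sum], Finset.mul_sum]
    exact Finset.sum_congr rfl fun w _ => by rw [hconst w]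
  have hpos : (0 : ℝ) < (Module.finrank ℚ K : ℝ) := by exact_mod_cast Module.finrank_pos
  rw [hsum] at htrace
  have h0 : μ (w₀ : InfinitePlace K) = 0 := by
    rcases mul_eq_zero.1 htrace with h | h
    · exact h
    · exact absurd h hpos.ne'
  funext w
  rw [Pi.zero_apply, hconst w, h0]

/-- **Rigidity of the archimedean weights in the product formula** (the "currency exchange" of [IUTchII]
Rmk 4.6.1, p. 140, at the number-field model): if real weights `λ_w`, `w ∈ 𝕍(K)^arc`, re-balance the product
formula for EVERY `x ∈ K^×` — `Σ_w λ_w·[K_w:ℝ]·log|x|_w = Σ_w [K_w:ℝ]·log|x|_w` (the right side being the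
nonarchimedean degree `Σ_{v∤∞} ord_v(x)·log q_v` of the principal divisor of `x`) — then `λ_w = 1` for every `w`:
the archimedean "local currencies" are determined by the nonarchimedean ones and the global structure.
[cite: Mochizuki2012, Rmk 4.6.1 p.140] -/
theorem archWeights_eq_one (lam : InfinitePlace K → ℝ)
    (h : ∀ x : K, x ≠ 0 →
      ∑ w : InfinitePlace K, lam w * ((w.mult : ℝ) * Real.log (w x)) =
        ∑ w : InfinitePlace K, ((w.mult : ℝ) * Real.log (w x))) :
    ∀ w, lam w = 1 := by
  have hμ := eq_zero_of_units_and_trace (K := K) (fun w => lam w - 1) (fun u => by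
      have hu : ((u : 𝓞 K) : K) ≠ 0 := by
        exact_mod_cast (Units.ne_zero u)
      have := h ((u : 𝓞 K) : K) hu
      simp only [sub_mul, one_mul, Finset.sum_sub_distrib]
      rw [sub_eq_zero]
      exact this) (by
      -- test against `x = 2`: every archimedean logarithm is `log 2 ≠ 0`
      have h2 := h (2 : K) two_ne_zero
      have e : ∀ w : InfinitePlace K, Real.log (w (2 : K)) = Real.log 2 := fun w => by
        rw [show (2 : K) = ((2 : ℕ) : K) by norm_num, InfinitePlace.map_natCast]; norm_num
      simp only [e] at h2
      have h2' : (∑ w : InfinitePlace K, (lam w - 1) * (w.mult : ℝ)) * Real.log 2 = 0 := by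
        rw [Finset.sum_mul]
        have : ∑ w : InfinitePlace K, (lam w - 1) * (w.mult : ℝ) * Real.log 2 =
            ∑ w : InfinitePlace K, lam w * ((w.mult : ℝ) * Real.log 2) -
              ∑ w : InfinitePlace K, ((w.mult : ℝ) * Real.log 2) := by
          rw [← Finset.sum_sub_distrib]
          exact Finset.sum_congr rfl fun w _ => by ring
        rw [this, h2, sub_self]
      have hlog : Real.log 2 ≠ 0 := by positivity
      exact (mul_eq_zero.1 h2').resolve_right hlog)
  intro w
  have := congrFun hμ w
  simpa [sub_eq_zero] using this

/-- Equivalent «uniqueness» phrasing: two archimedean weight systems that give EVERY `x ∈ K^×` the same total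
archimedean degree `N(x)` (whatever `N` is — e.g. the nonarchimedean degree of the principal divisor) COINCIDE.
[cite: Mochizuki2012, Rmk 4.6.1 p.140] -/
theorem archWeights_unique (lam lam' : InfinitePlace K → ℝ) (N : K → ℝ)
    (h : ∀ x : K, x ≠ 0 → ∑ w : InfinitePlace K, lam w * ((w.mult : ℝ) * Real.log (w x)) = N x)
    (h' : ∀ x : K, x ≠ 0 → ∑ w : InfinitePlace K, lam' w * ((w.mult : ℝ) * Real.log (w x)) = N x) :
    lam = lam' := by
  have hμ := eq_zero_of_units_and_trace (K := K) (fun w => lam w - lam' w) (fun u => by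
      have hu : ((u : 𝓞 K) : K) ≠ 0 := by exact_mod_cast (Units.ne_zero u)
      have e1 := h _ hu
      have e2 := h' _ hu
      simp only [sub_mul, Finset.sum_sub_distrib, e1, e2, sub_self]) (by
      have e1 := h (2 : K) two_ne_zero
      have e2 := h' (2 : K) two_ne_zero
      have e : ∀ w : InfinitePlace K, Real.log (w (2 : K)) = Real.log 2 := fun w => by
        rw [show (2 : K) = ((2 : ℕ) : K) by norm_num, InfinitePlace.map_natCast]; norm_num
      simp only [e] at e1 e2
      have hlog : Real.log 2 ≠ 0 := by positivity
      have h3 : (∑ w : InfinitePlace K, (lam w - lam' w) * (w.mult : ℝ)) * Real.log 2 = 0 := by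
        rw [Finset.sum_mul]
        have : ∑ w : InfinitePlace K, (lam w - lam' w) * (w.mult : ℝ) * Real.log 2 =
            ∑ w : InfinitePlace K, lam w * ((w.mult : ℝ) * Real.log 2) -
              ∑ w : InfinitePlace K, lam' w * ((w.mult : ℝ) * Real.log 2) := by
          rw [← Finset.sum_sub_distrib]
          exact Finset.sum_congr rfl fun w _ => by ring
        rw [this, e1, e2, sub_self]
      exact (mul_eq_zero.1 h3).resolve_right hlog)
  funext w
  have := congrFun hμ w
  simpa [sub_eq_zero] using this

end Literature.NumberTheory.NumberFields
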